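import Literature.Analysis.Fourier.TaylorGerm
import Mathlib.Tactic
import HarnessLib

/-!
# Linearity of the Cauchy-integral Taylor coefficients and the Taylor remainder

Technical complements to `TaylorOnClosedDisc` / `TransferCoefficients` for the pullback computation
of Calegari–Dimitrov–Tang, arXiv:2408.15403, §6.4 eq. (6.16) (where `f_i(Φ_s(z))` is expanded in
powers of `Φ_s(z)` and truncated at the relevant order): for functions continuous on the circle the
coefficients `taylorCoeff · R n` are additive and `ℂ`-linear (`taylorCoeff_add`, `taylorCoeff_const_mul`,
`taylorCoeff_sum`), the monomials have the expected coefficients (`taylorCoeff_pow_const`), and a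
function holomorphic on a closed disc has, for every order `r`, a holomorphic Taylor remainder
`f(x) = Σ_{q ≤ r} b_q x^q + x^{r+1} f_r(x)` with `b_q = taylorCoeff f ρ q` (`exists_taylorRemainder`,
iterated `dslope`).

No named facts.

## References

* [CalegariDimitrovTang2024] arXiv:2408.15403, §6.4 eq. (6.16).
-/

noncomputable section

open Complex Metric Filter Set

open scoped Real NNReal Topology

namespace Literature.Analysis.Fourier

namespace TorusCoeff

/-! ### Linearity -/

/-- The Cauchy kernel `(zⁿ)⁻¹ z⁻¹ g(z)` is continuous on the circle `|z| = R > 0` when `g` is.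
[folklore] -/
theorem continuousOn_kernel {g : ℂ → ℂ} {R : ℝ} (hR : 0 < R) (hg : ContinuousOn g (sphere 0 R)) (n : ℕ) :
    ContinuousOn (fun z : ℂ => (z ^ n)⁻¹ * (z⁻¹ * g z)) (sphere 0 R) := by
  have hz : ∀ z ∈ sphere (0 : ℂ) R, z ≠ 0 := by
    intro z hz h0; subst h0; simp at hz; exact hR.ne' hz.symm
  refine ContinuousOn.mul ?_ (ContinuousOn.mul ?_ hg)
  · exact ((continuousOn_pow n).inv₀ fun z hzmem => pow_ne_zero _ (hz z hzmem))
  · exact continuousOn_inv₀.mono fun z hzmem => hz z hzmem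

/-- **Additivity** of the Taylor coefficients (functions continuous on the circle). [folklore] -/
theorem taylorCoeff_add {f g : ℂ → ℂ} {R : ℝ} (hR : 0 < R) (hf : ContinuousOn f (sphere 0 R))
    (hg : ContinuousOn g (sphere 0 R)) (n : ℕ) :
    taylorCoeff (fun z => f z + g z) R n = taylorCoeff f R n + taylorCoeff g R n := by
  rw [taylorCoeff_eq_circleIntegral, taylorCoeff_eq_circleIntegral, taylorCoeff_eq_circleIntegral,
    ← mul_add, ← circleIntegral.integral_add
      ((continuousOn_kernel hR hf n).circleIntegrable hR.le) ((continuousOn_kernel hR hg n).circleIntegrable hR.le)]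
  congr 1
  exact circleIntegral.integral_congr hR.le fun z _ => by simp only [mul_add]

/-- **Homogeneity** of the Taylor coefficients. [folklore] -/
theorem taylorCoeff_const_mul (a : ℂ) (f : ℂ → ℂ) (R : ℝ) (n : ℕ) :
    taylorCoeff (fun z => a * f z) R n = a * taylorCoeff f R n := by
  rw [taylorCoeff_eq_circleIntegral, taylorCoeff_eq_circleIntegral]
  have : (fun z : ℂ => (z ^ n)⁻¹ * (z⁻¹ * (a * f z))) = fun z => a * ((z ^ n)⁻¹ * (z⁻¹ * f z)) := by
    funext z; ring
  rw [this, circleIntegral.integral_const_mul]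
  ring

/-- The zero function has zero Taylor coefficients. [folklore] -/
theorem taylorCoeff_zero_fun (R : ℝ) (n : ℕ) : taylorCoeff (fun _ => (0 : ℂ)) R n = 0 := by
  rw [taylorCoeff_eq_circleIntegral]
  simp [circleIntegral]

/-- `taylorCoeff` only depends on the values on the circle. [folklore] -/
theorem taylorCoeff_congr_sphere {f g : ℂ → ℂ} {R : ℝ} (hR : 0 ≤ R) (h : EqOn f g (sphere 0 R)) (n : ℕ) :
    taylorCoeff f R n = taylorCoeff g R n := by
  rw [taylorCoeff_eq_circleIntegral, taylorCoeff_eq_circleIntegral]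
  congr 1
  exact circleIntegral.integral_congr hR fun z hz => by simp only [h hz]

/-- **Finite sums** with coefficients: `taylorCoeff (Σ_q a_q g_q) = Σ_q a_q taylorCoeff g_q`.
[folklore] -/
theorem taylorCoeff_sum {ι : Type*} (s : Finset ι) (a : ι → ℂ) (g : ι → ℂ → ℂ) {R : ℝ} (hR : 0 < R)
    (hg : ∀ i ∈ s, ContinuousOn (g i) (sphere 0 R)) (n : ℕ) :
    taylorCoeff (fun z => ∑ i ∈ s, a i * g i z) R n = ∑ i ∈ s, a i * taylorCoeff (g i) R n := by
  classical
  induction s using Finset.induction_on with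
  | empty => simp [taylorCoeff_zero_fun]
  | insert i s hi ih =>
    have hgi := hg i (Finset.mem_insert_self i s)
    have hs : ∀ j ∈ s, ContinuousOn (g j) (sphere 0 R) := fun j hj => hg j (Finset.mem_insert_of_mem hj)
    rw [Finset.sum_insert hi, ← ih hs]
    have hsum : ContinuousOn (fun z => ∑ j ∈ s, a j * g j z) (sphere 0 R) :=
      continuousOn_finsetSum _ fun j hj => continuousOn_const.mul (hs j hj)
    have heq : (fun z => ∑ j ∈ insert i s, a j * g j z) = fun z => a i * g i z + ∑ j ∈ s, a j * g j z := by
      funext z; rw [Finset.sum_insert hi]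
    have hci : ContinuousOn (fun z => a i * g i z) (sphere 0 R) := continuousOn_const.mul hgi
    rw [heq, taylorCoeff_add hR hci hsum, taylorCoeff_const_mul]

/-! ### Monomials -/

/-- The constant function `1`: `taylorCoeff 1 R n = [n = 0]` (`R > 0`). [folklore] -/
theorem taylorCoeff_one {R : ℝ≥0} (hR : 0 < R) (n : ℕ) :
    taylorCoeff (fun _ => (1 : ℂ)) R n = if n = 0 then 1 else 0 := by
  have h1 := hasFPowerSeriesAt_cauchyPowerSeries hR (differentiableOn_const (1 : ℂ))
  have h2 : HasFPowerSeriesAt (fun _ : ℂ => (1 : ℂ)) (constFormalMultilinearSeries ℂ ℂ (1 : ℂ)) 0 :=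
    hasFPowerSeriesAt_const
  have hps := h1.eq_formalMultilinearSeries h2
  unfold taylorCoeff
  rw [hps]
  split_ifs with hn
  · subst hn; simp
  · rw [constFormalMultilinearSeries_apply_of_nonzero hn]; rfl

/-- **Monomials**: `taylorCoeff (z ↦ z^q) R n = [n = q]` (`R > 0`). [folklore] -/
theorem taylorCoeff_pow {R : ℝ≥0} (hR : 0 < R) (q n : ℕ) :
    taylorCoeff (fun z => z ^ q) R n = if n = q then 1 else 0 := by
  have h := taylorCoeff_pow_mul hR (differentiableOn_const (1 : ℂ)) q n
  simp only [mul_one] at h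
  rw [h]
  by_cases hq : q ≤ n
  · rw [if_pos hq, taylorCoeff_one hR]
    by_cases hnq : n = q
    · subst hnq; simp
    · rw [if_neg (by omega), if_neg hnq]
  · rw [if_neg hq, if_neg (by omega)]

/-! ### The Taylor remainder -/

/-- **Taylor remainder by iterated `dslope`**: a function holomorphic on `|x| ≤ ρ` (`ρ > 0`)
writes, for every `r`, as `f(x) = Σ_{q ≤ r} b_q x^q + x^{r+1} f_r(x)` on the closed disc with
`f_r` holomorphic there and `b_q = taylorCoeff f ρ q`. [folklore] -/
theorem exists_taylorRemainder {f : ℂ → ℂ} {ρ : ℝ≥0} (hρ : 0 < ρ)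
    (hf : DifferentiableOn ℂ f (closedBall 0 ρ)) (r : ℕ) :
    ∃ fr : ℂ → ℂ, DifferentiableOn ℂ fr (closedBall 0 ρ) ∧
      ∀ x ∈ closedBall (0 : ℂ) ρ,
        f x = (∑ q ∈ Finset.range (r + 1), taylorCoeff f ρ q * x ^ q) + x ^ (r + 1) * fr x := by
  have hmem : closedBall (0 : ℂ) ρ ∈ 𝓝 (0 : ℂ) := closedBall_mem_nhds _ (by exact_mod_cast hρ)
  induction r with
  | zero =>
    refine ⟨dslope f 0, (differentiableOn_dslope hmem).mpr hf, fun x _ => ?_⟩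
    rw [Finset.sum_range_one, pow_zero, mul_one, taylorCoeff_zero_eq hρ hf, zero_add, pow_one]
    have := sub_smul_dslope f 0 x
    rw [sub_zero, smul_eq_mul] at this
    linear_combination -this
  | succ r ih =>
    obtain ⟨fr, hfr, hdec⟩ := ih
    have hfr' : DifferentiableOn ℂ (dslope fr 0) (closedBall 0 ρ) := (differentiableOn_dslope hmem).mpr hfr
    -- identify `fr 0` with the next Taylor coefficient
    have hcoef : taylorCoeff f ρ (r + 1) = fr 0 := by
      have hsphere : EqOn f (fun x => (∑ q ∈ Finset.range (r + 1), taylorCoeff f ρ q * x ^ q) + x ^ (r + 1) * fr x)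
          (sphere 0 ρ) := fun x hx => hdec x (sphere_subset_closedBall hx)
      have hρr : (0 : ℝ) < ρ := by exact_mod_cast hρ
      rw [taylorCoeff_congr_sphere hρr.le hsphere]
      have hcont1 : ContinuousOn (fun x => ∑ q ∈ Finset.range (r + 1), taylorCoeff f ρ q * x ^ q) (sphere 0 ρ) :=
        continuousOn_finsetSum _ fun q _ => continuousOn_const.mul (continuousOn_pow q)
      have hcont2 : ContinuousOn (fun x => x ^ (r + 1) * fr x) (sphere 0 ρ) :=
        (continuousOn_pow _).mul (hfr.continuousOn.mono sphere_subset_closedBall)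
      rw [taylorCoeff_add hρr hcont1 hcont2,
        taylorCoeff_sum _ _ (fun q x => x ^ q) hρr (fun q _ => continuousOn_pow q),
        taylorCoeff_pow_mul hρ hfr, if_pos le_rfl, Nat.sub_self, taylorCoeff_zero_eq hρ hfr]
      rw [Finset.sum_eq_zero fun q hq => ?_, zero_add]
      rw [taylorCoeff_pow hρ, if_neg (by have := Finset.mem_range.mp hq; omega), mul_zero]
    refine ⟨dslope fr 0, hfr', fun x hx => ?_⟩
    rw [Finset.sum_range_succ, hcoef, hdec x hx]
    have := sub_smul_dslope fr 0 x
    rw [sub_zero, smul_eq_mul] at this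
    -- `fr x = fr 0 + x * dslope fr 0 x`
    have hfx : fr x = fr 0 + x * dslope fr 0 x := by linear_combination -this
    rw [hfx]; ring

end TorusCoeff

end Literature.Analysis.Fourier
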